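import Mathlib.Tactic
import HarnessLib
import HarnessLib.Audit.Tags
import Summits.CriticalPhenomena.PercolationContinuityZ3.Theorems.PercNearOneGluingNoHeavyLowerTailSahiAntichainSplitTwo
import Summits.CriticalPhenomena.PercolationContinuityZ3.Theorems.PercNearOneGluingNoHeavyLowerTailSahiAntichainSplitSunflower

/-!
# Antichains, meets plus joins: a `2 + 2` split creates three new labels

Support file (seat `prim-masterthm-p1`, gen 36; `--supports stmt-CriticalPhenomena-4575`).  No `sorry`, no new definitions, standard
axioms.  Memo `run/shared/lean/prim/prim-masterthm/FROM-prim-masterthm-p1-g36-DUALITY-PROJECTION-SUNFLOWER.md` §7.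

SETTING (files `…SahiAntichainSplit*`): at a point `r` with `above P r = {a, a'}` and `below P r = {b, b'}` (a four-member
antichain split `2 + 2`), `newLabels P r` counts the cross meets other than `b ∩ b'` plus the cross joins other than `a ∪ a'`.
The two-member step (`…SplitTwo`) gives `newLabels ≥ 2`.

NEW HERE ([this work], gen 36): `three_le_newLabels_of_two_two` — in fact `newLabels ≥ 3`.  [Case analysis on which of the two
columns `{a ∪ b, a' ∪ b}`, `{a ∪ b', a' ∪ b'}` are constant; a constant column `a ∪ b = a' ∪ b` puts `a Δ a'` inside `b` and makes
the two cross meets of that column distinct (lattice cancellation `eq_of_inter_eq_of_union_eq`); the bookkeeping then always finds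
three new labels, the extreme sub-cases being contradicted by the antichain property.]  This is the `2 + 2` half of «every
four-member antichain has `#meets + #joins ≥ 7`» (companion file `…SplitSeven`), the step from V5 for six to V5 for seven members.
HONEST FRAMING: V5 in general remains OPEN. [this work]
-/

namespace Summit.CriticalPhenomena.PercolationContinuityZ3.Theorems.SahiColouredDaykin

open Finset

variable {α : Type*} [DecidableEq α]

/-- Joins of a pair. [this work] -/
theorem joins_pair {a a' : Finset α} (h : a ≠ a') : joins ({a, a'} : Finset (Finset α)) = {a ∪ a'} := by
  ext W
  rw [mem_joins_iff, mem_singleton]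
  constructor
  · rintro ⟨x, hx, y, hy, hxy, rfl⟩
    simp only [mem_insert, mem_singleton] at hx hy
    rcases hx with rfl | rfl <;> rcases hy with rfl | rfl
    · exact absurd rfl hxy
    · rfl
    · exact union_comm _ _
    · exact absurd rfl hxy
  · rintro rfl
    exact ⟨a, by simp, a', by simp, h, rfl⟩

/-- Meets of a pair. [this work] -/
theorem meets_pair {b b' : Finset α} (h : b ≠ b') : meets ({b, b'} : Finset (Finset α)) = {b ∩ b'} := by
  ext Z
  rw [mem_meets_iff, mem_singleton]
  constructor
  · rintro ⟨x, hx, y, hy, hxy, rfl⟩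
    simp only [mem_insert, mem_singleton] at hx hy
    rcases hx with rfl | rfl <;> rcases hy with rfl | rfl
    · exact absurd rfl hxy
    · rfl
    · exact inter_comm _ _
    · exact absurd rfl hxy
  · rintro rfl
    exact ⟨b, by simp, b', by simp, h, rfl⟩

/-- Counting new labels from explicit subfamilies. [this work] -/
theorem card_add_card_le_newLabels {P : Finset (Finset α)} {r : α} {S T : Finset (Finset α)}
    (hS : S ⊆ newMeets P r) (hT : T ⊆ newJoins P r) : #S + #T ≤ newLabels P r := by
  unfold newLabels
  exact Nat.add_le_add (card_le_card hS) (card_le_card hT)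

section TwoTwo

variable {P : Finset (Finset α)} {r : α} {a a' b b' : Finset α}

/-- **The `2 + 2` step.**  If `above P r = {a, a'}` and `below P r = {b, b'}` in an antichain, the split at `r` creates at least
three new labels. [this work] -/
theorem three_le_newLabels_of_two_two (hanti : IsAntichain (· ⊆ ·) (P : Set (Finset α)))
    (hA : above P r = {a, a'}) (hB : below P r = {b, b'}) (haa : a ≠ a') (hbb : b ≠ b') : 3 ≤ newLabels P r := by
  have ha : a ∈ above P r := by rw [hA]; simp
  have ha' : a' ∈ above P r := by rw [hA]; simp
  have hb : b ∈ below P r := by rw [hB]; simp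
  have hb' : b' ∈ below P r := by rw [hB]; simp
  obtain ⟨haP, hra⟩ := mem_above_iff.1 ha
  obtain ⟨ha'P, hra'⟩ := mem_above_iff.1 ha'
  obtain ⟨hbP, hrb⟩ := mem_below_iff.1 hb
  obtain ⟨hb'P, hrb'⟩ := mem_below_iff.1 hb'
  have naa' : ¬ a ⊆ a' := hanti (mem_coe.2 haP) (mem_coe.2 ha'P) haa
  have na'a : ¬ a' ⊆ a := hanti (mem_coe.2 ha'P) (mem_coe.2 haP) haa.symm
  have nbb' : ¬ b ⊆ b' := hanti (mem_coe.2 hbP) (mem_coe.2 hb'P) hbb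
  have nb'b : ¬ b' ⊆ b := hanti (mem_coe.2 hb'P) (mem_coe.2 hbP) hbb.symm
  have nxy : ∀ {x y : Finset α}, x ∈ above P r → y ∈ below P r → ¬ y ⊆ x := by
    intro x y hx hy
    obtain ⟨hxP, hrx⟩ := mem_above_iff.1 hx
    obtain ⟨hyP, hry⟩ := mem_below_iff.1 hy
    exact hanti (mem_coe.2 hyP) (mem_coe.2 hxP) (by rintro rfl; exact hry hrx)
  obtain ⟨z, hza, hza'⟩ := not_subset.1 naa'     -- z ∈ a \ a'
  obtain ⟨z', hz'a', hz'a⟩ := not_subset.1 na'a  -- z' ∈ a' \ a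
  obtain ⟨w, hwb, hwb'⟩ := not_subset.1 nbb'     -- w ∈ b \ b'
  obtain ⟨w', hw'b', hw'b⟩ := not_subset.1 nb'b  -- w' ∈ b' \ b
  have hJ : joins (above P r) = {a ∪ a'} := by rw [hA, joins_pair haa]
  have hM : meets (below P r) = {b ∩ b'} := by rw [hB, meets_pair hbb]
  have nJ : ∀ {x y : Finset α}, x ∈ above P r → y ∈ below P r → x ∪ y ≠ a ∪ a' → x ∪ y ∈ newJoins P r := by
    intro x y hx hy hne
    rw [union_mem_newJoins_iff hx hy, hJ, mem_singleton]; exact hne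
  have nM : ∀ {x y : Finset α}, x ∈ above P r → y ∈ below P r → x ∩ y ≠ b ∩ b' → x ∩ y ∈ newMeets P r := by
    intro x y hx hy hne
    rw [inter_mem_newMeets_iff hx hy, hM, mem_singleton]; exact hne
  have from21 : ∀ {Z₁ Z₂ W : Finset α}, Z₁ ∈ newMeets P r → Z₂ ∈ newMeets P r → Z₁ ≠ Z₂ → W ∈ newJoins P r →
      3 ≤ newLabels P r := by
    intro Z₁ Z₂ W h1 h2 h12 hW
    have := card_add_card_le_newLabels (S := {Z₁, Z₂}) (T := {W})
      (by intro Z hZ; rcases mem_insert.1 hZ with rfl | hZ; exact h1; rw [mem_singleton.1 hZ]; exact h2)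
      (by intro V hV; rw [mem_singleton.1 hV]; exact hW)
    rw [card_pair h12, card_singleton] at this; omega
  have from12 : ∀ {Z W₁ W₂ : Finset α}, Z ∈ newMeets P r → W₁ ∈ newJoins P r → W₂ ∈ newJoins P r → W₁ ≠ W₂ →
      3 ≤ newLabels P r := by
    intro Z W₁ W₂ hZ h1 h2 h12
    have := card_add_card_le_newLabels (S := {Z}) (T := {W₁, W₂})
      (by intro V hV; rw [mem_singleton.1 hV]; exact hZ)
      (by intro V hV; rcases mem_insert.1 hV with rfl | hV; exact h1; rw [mem_singleton.1 hV]; exact h2)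
    rw [card_pair h12, card_singleton] at this; omega
  have from30 : ∀ {Z₁ Z₂ Z₃ : Finset α}, Z₁ ∈ newMeets P r → Z₂ ∈ newMeets P r → Z₃ ∈ newMeets P r →
      Z₁ ≠ Z₂ → Z₁ ≠ Z₃ → Z₂ ≠ Z₃ → 3 ≤ newLabels P r := by
    intro Z₁ Z₂ Z₃ h1 h2 h3 h12 h13 h23
    have := card_add_card_le_newLabels (S := {Z₁, Z₂, Z₃}) (T := ∅)
      (by
        intro Z hZ
        rcases mem_insert.1 hZ with rfl | hZ; exact h1
        rcases mem_insert.1 hZ with rfl | hZ; exact h2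
        rw [mem_singleton.1 hZ]; exact h3)
      (empty_subset _)
    rw [card_eq_three.2 ⟨Z₁, Z₂, Z₃, h12, h13, h23, rfl⟩, card_empty] at this; omega
  have from03 : ∀ {W₁ W₂ W₃ : Finset α}, W₁ ∈ newJoins P r → W₂ ∈ newJoins P r → W₃ ∈ newJoins P r →
      W₁ ≠ W₂ → W₁ ≠ W₃ → W₂ ≠ W₃ → 3 ≤ newLabels P r := by
    intro W₁ W₂ W₃ h1 h2 h3 h12 h13 h23
    have := card_add_card_le_newLabels (S := ∅) (T := {W₁, W₂, W₃}) (empty_subset _)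
      (by
        intro W hW
        rcases mem_insert.1 hW with rfl | hW; exact h1
        rcases mem_insert.1 hW with rfl | hW; exact h2
        rw [mem_singleton.1 hW]; exact h3)
    rw [card_eq_three.2 ⟨W₁, W₂, W₃, h12, h13, h23, rfl⟩, card_empty] at this; omega
  have colcancel : ∀ {x x' y : Finset α}, x ∩ y = x' ∩ y → x ∪ y = x' ∪ y → x = x' := by
    intro x x' y hi hu
    exact eq_of_inter_eq_of_union_eq (a := y) (by rw [inter_comm y x, inter_comm y x', hi]) (by rw [union_comm y x, union_comm y x', hu])
  have colconst : ∀ {x x' y : Finset α} {t : α}, x ∪ y = x' ∪ y → t ∈ x → t ∉ x' → t ∈ y := by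
    intro x x' y t hu htx htx'
    have : t ∈ x' ∪ y := by rw [← hu]; exact mem_union_left _ htx
    rcases mem_union.1 this with h | h
    · exact absurd h htx'
    · exact h
  have aux : ∀ {y₁ y₂ : Finset α}, y₁ ∈ below P r → y₂ ∈ below P r → y₁ ≠ y₂ → (∃ t ∈ y₁, t ∉ y₂) → (∃ t ∈ y₂, t ∉ y₁) →
      b ∩ b' = y₁ ∩ y₂ → a ∪ y₁ = a' ∪ y₁ → 3 ≤ newLabels P r := by
    intro y₁ y₂ hy₁ hy₂ hyy hex₁ hex₂ hm hα
    obtain ⟨t₁, ht₁y₁, ht₁y₂⟩ := hex₁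
    obtain ⟨t₂, ht₂y₂, ht₂y₁⟩ := hex₂
    have m1 : a ∩ y₁ ≠ a' ∩ y₁ := fun h => haa (colcancel h hα)
    have hzy₁ : z ∈ y₁ := colconst hα hza hza'
    have hz'y₁ : z' ∈ y₁ := colconst hα.symm hz'a' hz'a
    have oneNew : ∃ Z ∈ newMeets P r, Z = a ∩ y₁ ∨ Z = a' ∩ y₁ := by
      by_cases h : a ∩ y₁ = b ∩ b'
      · refine ⟨a' ∩ y₁, nM ha' hy₁ ?_, Or.inr rfl⟩
        intro h'; exact m1 (h.trans h'.symm)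
      · exact ⟨a ∩ y₁, nM ha hy₁ h, Or.inl rfl⟩
    by_cases hβ : a ∪ y₂ = a' ∪ y₂
    · -- both columns constant
      have m2 : a ∩ y₂ ≠ a' ∩ y₂ := fun h => haa (colcancel h hβ)
      have hzy₂ : z ∈ y₂ := colconst hβ hza hza'
      have hz'y₂ : z' ∈ y₂ := colconst hβ.symm hz'a' hz'a
      by_cases hv : a ∪ y₁ = a ∪ y₂
      · -- all four cross joins coincide: then `y₁ Δ y₂ ⊆ a ∩ a'` and three cross meets are new and distinct
        have ht₁a : t₁ ∈ a := colconst (by rw [union_comm y₁ a, union_comm y₂ a, hv]) ht₁y₁ ht₁y₂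
        have hv' : a' ∪ y₁ = a' ∪ y₂ := by rw [← hα, hv, hβ]
        have ht₁a' : t₁ ∈ a' := colconst (by rw [union_comm y₁ a', union_comm y₂ a', hv']) ht₁y₁ ht₁y₂
        have ht₂a : t₂ ∈ a := colconst (by rw [union_comm y₂ a, union_comm y₁ a, ← hv]) ht₂y₂ ht₂y₁
        have hm₁ : t₁ ∉ b ∩ b' := by rw [hm]; exact fun h => ht₁y₂ (mem_inter.1 h).2
        have hm₂ : t₂ ∉ b ∩ b' := by rw [hm]; exact fun h => ht₂y₁ (mem_inter.1 h).1
        have n1 : a ∩ y₁ ∈ newMeets P r := nM ha hy₁ (fun h => hm₁ (h ▸ mem_inter.2 ⟨ht₁a, ht₁y₁⟩))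
        have n2 : a' ∩ y₁ ∈ newMeets P r := nM ha' hy₁ (fun h => hm₁ (h ▸ mem_inter.2 ⟨ht₁a', ht₁y₁⟩))
        have n3 : a ∩ y₂ ∈ newMeets P r := nM ha hy₂ (fun h => hm₂ (h ▸ mem_inter.2 ⟨ht₂a, ht₂y₂⟩))
        refine from30 n1 n2 n3 m1 ?_ ?_
        · intro h; have : t₁ ∈ a ∩ y₂ := h ▸ mem_inter.2 ⟨ht₁a, ht₁y₁⟩; exact ht₁y₂ (mem_inter.1 this).2
        · intro h; have : t₁ ∈ a ∩ y₂ := h ▸ mem_inter.2 ⟨ht₁a', ht₁y₁⟩; exact ht₁y₂ (mem_inter.1 this).2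
      · -- the two column values differ
        by_cases h3 : a ∩ y₁ ≠ a ∩ y₂ ∧ a' ∩ y₁ ≠ a ∩ y₂ ∨ a ∩ y₁ ≠ a' ∩ y₂ ∧ a' ∩ y₁ ≠ a' ∩ y₂
        · -- three distinct cross meets: two of them new, plus a new join among the two column values
          have newJ : ∃ W ∈ newJoins P r, True := by
            by_cases hu : a ∪ y₁ = a ∪ a'
            · exact ⟨a ∪ y₂, nJ ha hy₂ (fun h => hv (hu.trans h.symm)), trivial⟩
            · exact ⟨a ∪ y₁, nJ ha hy₁ hu, trivial⟩
          obtain ⟨W, hW, -⟩ := newJ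
          rcases h3 with ⟨h31, h32⟩ | ⟨h31, h32⟩
          · -- meets a∩y₁, a'∩y₁, a∩y₂ pairwise distinct; at most one equals m
            by_cases e1 : a ∩ y₁ = b ∩ b'
            · exact from21 (nM ha' hy₁ (fun h => m1 (e1.trans h.symm))) (nM ha hy₂ (fun h => h31 (e1.trans h.symm))) h32 hW
            · by_cases e2 : a' ∩ y₁ = b ∩ b'
              · exact from21 (nM ha hy₁ e1) (nM ha hy₂ (fun h => h32 (e2.trans h.symm))) h31 hW
              · exact from21 (nM ha hy₁ e1) (nM ha' hy₁ e2) m1 hW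
          · by_cases e1 : a ∩ y₁ = b ∩ b'
            · exact from21 (nM ha' hy₁ (fun h => m1 (e1.trans h.symm))) (nM ha' hy₂ (fun h => h31 (e1.trans h.symm))) h32 hW
            · by_cases e2 : a' ∩ y₁ = b ∩ b'
              · exact from21 (nM ha hy₁ e1) (nM ha' hy₂ (fun h => h32 (e2.trans h.symm))) h31 hW
              · exact from21 (nM ha hy₁ e1) (nM ha' hy₁ e2) m1 hW
        · -- {a∩y₁, a'∩y₁} = {a∩y₂, a'∩y₂} with the only consistent matching a∩y₁ = a∩y₂, a'∩y₁ = a'∩y₂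
          push Not at h3
          obtain ⟨h31, h32⟩ := h3
          have e11 : a ∩ y₁ = a ∩ y₂ := by
            by_contra hne
            have h' := h31 hne   -- a' ∩ y₁ = a ∩ y₂
            have : z' ∈ a ∩ y₂ := h' ▸ mem_inter.2 ⟨hz'a', hz'y₁⟩
            exact hz'a (mem_inter.1 this).1
          have e22 : a' ∩ y₁ = a' ∩ y₂ := by
            by_contra hne
            have h' := (h32 (fun h => by
              have : z ∈ a' ∩ y₂ := h ▸ mem_inter.2 ⟨hza, hzy₁⟩
              exact hza' (mem_inter.1 this).1))
            exact hne h'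
          have hsub12 : ∀ t ∈ y₁, t ∈ a ∪ a' → t ∈ y₂ := by
            intro t hty ht
            rcases mem_union.1 ht with hta | hta
            · have : t ∈ a ∩ y₂ := e11 ▸ mem_inter.2 ⟨hta, hty⟩; exact (mem_inter.1 this).2
            · have : t ∈ a' ∩ y₂ := e22 ▸ mem_inter.2 ⟨hta, hty⟩; exact (mem_inter.1 this).2
          have hsub21 : ∀ t ∈ y₂, t ∈ a ∪ a' → t ∈ y₁ := by
            intro t hty ht
            rcases mem_union.1 ht with hta | hta
            · have : t ∈ a ∩ y₁ := e11.symm ▸ mem_inter.2 ⟨hta, hty⟩; exact (mem_inter.1 this).2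
            · have : t ∈ a' ∩ y₁ := e22.symm ▸ mem_inter.2 ⟨hta, hty⟩; exact (mem_inter.1 this).2
          have nu1 : a ∪ y₁ ≠ a ∪ a' := by
            intro hu
            have : y₁ ⊆ y₂ := fun t ht => hsub12 t ht (hu ▸ mem_union_right _ ht)
            exact ht₁y₂ (this ht₁y₁)
          have nu2 : a ∪ y₂ ≠ a ∪ a' := by
            intro hu
            have : y₂ ⊆ y₁ := fun t ht => hsub21 t ht (hu ▸ mem_union_right _ ht)
            exact ht₂y₁ (this ht₂y₂)
          obtain ⟨Z, hZ, -⟩ := oneNew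
          exact from12 hZ (nJ ha hy₁ nu1) (nJ ha hy₂ nu2) hv
    · -- column y₁ constant, column y₂ not: the joins a ∪ y₂ ≠ a' ∪ y₂, at least one new
      by_cases hu2 : a ∪ y₂ = a ∪ a'
      · -- a' ∪ y₂ is new
        have nW : a' ∪ y₂ ∈ newJoins P r := nJ ha' hy₂ (fun h => hβ (hu2.trans h.symm))
        by_cases hvu : a ∪ y₁ = a ∪ a'
        · -- a ∪ y₁ = a ∪ y₂: so a ∩ y₁ ≠ a ∩ y₂; three cross meets a∩y₁, a'∩y₁, a∩y₂ pairwise distinct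
          have e : a ∩ y₁ ≠ a ∩ y₂ := fun h => hyy (eq_of_inter_eq_of_union_eq h (hvu.trans hu2.symm))
          have e' : a' ∩ y₁ ≠ a ∩ y₂ := by
            intro h; have : z' ∈ a ∩ y₂ := h ▸ mem_inter.2 ⟨hz'a', hz'y₁⟩; exact hz'a (mem_inter.1 this).1
          by_cases e1 : a ∩ y₁ = b ∩ b'
          · exact from21 (nM ha' hy₁ (fun h => m1 (e1.trans h.symm))) (nM ha hy₂ (fun h => e (e1.trans h.symm))) e' nW
          · by_cases e2 : a' ∩ y₁ = b ∩ b'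
            · exact from21 (nM ha hy₁ e1) (nM ha hy₂ (fun h => e' (e2.trans h.symm))) e nW
            · exact from21 (nM ha hy₁ e1) (nM ha' hy₁ e2) m1 nW
        · -- a ∪ y₁ is a second new join unless it equals a' ∪ y₂
          by_cases hvw : a ∪ y₁ = a' ∪ y₂
          · -- then a' ∪ y₁ = a' ∪ y₂: a' ∩ y₁ ≠ a' ∩ y₂; meets a∩y₁, a'∩y₁, a'∩y₂
            have e : a' ∩ y₁ ≠ a' ∩ y₂ := fun h => hyy (eq_of_inter_eq_of_union_eq h (hα.symm.trans hvw))
            have e' : a ∩ y₁ ≠ a' ∩ y₂ := by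
              intro h; have : z ∈ a' ∩ y₂ := h ▸ mem_inter.2 ⟨hza, hzy₁⟩; exact hza' (mem_inter.1 this).1
            by_cases e1 : a ∩ y₁ = b ∩ b'
            · exact from21 (nM ha' hy₁ (fun h => m1 (e1.trans h.symm))) (nM ha' hy₂ (fun h => e' (e1.trans h.symm))) e nW
            · by_cases e2 : a' ∩ y₁ = b ∩ b'
              · exact from21 (nM ha hy₁ e1) (nM ha' hy₂ (fun h => e (e2.trans h.symm))) e' nW
              · exact from21 (nM ha hy₁ e1) (nM ha' hy₁ e2) m1 nW
          · obtain ⟨Z, hZ, -⟩ := oneNew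
            exact from12 hZ (nJ ha hy₁ hvu) nW hvw
      · -- a ∪ y₂ is new
        have nW : a ∪ y₂ ∈ newJoins P r := nJ ha hy₂ hu2
        by_cases hu2' : a' ∪ y₂ = a ∪ a'
        · by_cases hvu : a ∪ y₁ = a ∪ a'
          · -- a' ∪ y₁ = a ∪ a' = a' ∪ y₂: a' ∩ y₁ ≠ a' ∩ y₂; meets a∩y₁, a'∩y₁, a'∩y₂
            have e : a' ∩ y₁ ≠ a' ∩ y₂ := fun h => hyy (eq_of_inter_eq_of_union_eq h (hα.symm.trans (hvu.trans hu2'.symm)))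
            have e' : a ∩ y₁ ≠ a' ∩ y₂ := by
              intro h; have : z ∈ a' ∩ y₂ := h ▸ mem_inter.2 ⟨hza, hzy₁⟩; exact hza' (mem_inter.1 this).1
            by_cases e1 : a ∩ y₁ = b ∩ b'
            · exact from21 (nM ha' hy₁ (fun h => m1 (e1.trans h.symm))) (nM ha' hy₂ (fun h => e' (e1.trans h.symm))) e nW
            · by_cases e2 : a' ∩ y₁ = b ∩ b'
              · exact from21 (nM ha hy₁ e1) (nM ha' hy₂ (fun h => e (e2.trans h.symm))) e' nW
              · exact from21 (nM ha hy₁ e1) (nM ha' hy₁ e2) m1 nW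
          · by_cases hvw : a ∪ y₁ = a ∪ y₂
            · -- a ∩ y₁ ≠ a ∩ y₂; meets a∩y₁, a'∩y₁, a∩y₂
              have e : a ∩ y₁ ≠ a ∩ y₂ := fun h => hyy (eq_of_inter_eq_of_union_eq h hvw)
              have e' : a' ∩ y₁ ≠ a ∩ y₂ := by
                intro h; have : z' ∈ a ∩ y₂ := h ▸ mem_inter.2 ⟨hz'a', hz'y₁⟩; exact hz'a (mem_inter.1 this).1
              by_cases e1 : a ∩ y₁ = b ∩ b'
              · exact from21 (nM ha' hy₁ (fun h => m1 (e1.trans h.symm))) (nM ha hy₂ (fun h => e (e1.trans h.symm))) e' nW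
              · by_cases e2 : a' ∩ y₁ = b ∩ b'
                · exact from21 (nM ha hy₁ e1) (nM ha hy₂ (fun h => e' (e2.trans h.symm))) e nW
                · exact from21 (nM ha hy₁ e1) (nM ha' hy₁ e2) m1 nW
            · obtain ⟨Z, hZ, -⟩ := oneNew
              exact from12 hZ (nJ ha hy₁ hvu) nW hvw
        · -- both joins of column y₂ are new and distinct
          obtain ⟨Z, hZ, -⟩ := oneNew
          exact from12 hZ nW (nJ ha' hy₂ hu2') hβ
  by_cases hα : a ∪ b = a' ∪ b
  · exact aux hb hb' hbb ⟨w, hwb, hwb'⟩ ⟨w', hw'b', hw'b⟩ rfl hα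
  by_cases hβ : a ∪ b' = a' ∪ b'
  · exact aux hb' hb hbb.symm ⟨w', hw'b', hw'b⟩ ⟨w, hwb, hwb'⟩ (inter_comm b b') hβ
  by_cases hρ : a ∪ b = a ∪ b'
  · -- row `a` constant: b Δ b' ⊆ a, two new meets in row a, and a new join in column b
    have hwa : w ∈ a := colconst (by rw [union_comm b a, union_comm b' a, hρ]) hwb hwb'
    have hw'a : w' ∈ a := colconst (by rw [union_comm b' a, union_comm b a, ← hρ]) hw'b' hw'b
    have n1 : a ∩ b ∈ newMeets P r := nM ha hb (fun h => hwb' (mem_inter.1 (h ▸ mem_inter.2 ⟨hwa, hwb⟩ : w ∈ b ∩ b')).2)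
    have n2 : a ∩ b' ∈ newMeets P r := nM ha hb' (fun h => hw'b (mem_inter.1 (h ▸ mem_inter.2 ⟨hw'a, hw'b'⟩ : w' ∈ b ∩ b')).1)
    have n12 : a ∩ b ≠ a ∩ b' := by
      intro h; have : w ∈ a ∩ b' := h ▸ mem_inter.2 ⟨hwa, hwb⟩; exact hwb' (mem_inter.1 this).2
    by_cases hu : a ∪ b = a ∪ a'
    · exact from21 n1 n2 n12 (nJ ha' hb (fun h => hα (hu.trans h.symm)))
    · exact from21 n1 n2 n12 (nJ ha hb hu)
  by_cases hρ' : a' ∪ b = a' ∪ b'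
  · have hwa : w ∈ a' := colconst (by rw [union_comm b a', union_comm b' a', hρ']) hwb hwb'
    have hw'a : w' ∈ a' := colconst (by rw [union_comm b' a', union_comm b a', ← hρ']) hw'b' hw'b
    have n1 : a' ∩ b ∈ newMeets P r := nM ha' hb (fun h => hwb' (mem_inter.1 (h ▸ mem_inter.2 ⟨hwa, hwb⟩ : w ∈ b ∩ b')).2)
    have n2 : a' ∩ b' ∈ newMeets P r := nM ha' hb' (fun h => hw'b (mem_inter.1 (h ▸ mem_inter.2 ⟨hw'a, hw'b'⟩ : w' ∈ b ∩ b')).1)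
    have n12 : a' ∩ b ≠ a' ∩ b' := by
      intro h; have : w ∈ a' ∩ b' := h ▸ mem_inter.2 ⟨hwa, hwb⟩; exact hwb' (mem_inter.1 this).2
    by_cases hu : a ∪ b = a ∪ a'
    · exact from21 n1 n2 n12 (nJ ha' hb (fun h => hα (hu.trans h.symm)))
    · exact from21 n1 n2 n12 (nJ ha hb hu)
  have notu : ∀ {x x' y : Finset α}, x ∈ above P r → x' ∈ above P r → y ∈ below P r → x ≠ x' → (∃ t ∈ x', t ∉ x) →
      x' ∩ y = b ∩ b' → b ∩ b' ⊆ x → x ∪ y ≠ x ∪ x' := by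
    intro x x' y hx hx' hy hxx' hex hmeet hmx hu
    obtain ⟨t, htx', htx⟩ := hex
    have hty : t ∈ y := by
      have : t ∈ x ∪ y := by rw [hu]; exact mem_union_right _ htx'
      rcases mem_union.1 this with h | h
      · exact absurd h htx
      · exact h
    have : t ∈ b ∩ b' := hmeet ▸ mem_inter.2 ⟨htx', hty⟩
    exact htx (hmx this)
  have twoOfThree : ∀ {Z W₁ W₂ W₃ : Finset α}, Z ∈ newMeets P r →
      (W₁ ≠ a ∪ a' → W₁ ∈ newJoins P r) → (W₂ ≠ a ∪ a' → W₂ ∈ newJoins P r) → (W₃ ≠ a ∪ a' → W₃ ∈ newJoins P r) →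
      W₁ ≠ W₂ → W₁ ≠ W₃ → W₂ ≠ W₃ → 3 ≤ newLabels P r := by
    intro Z W₁ W₂ W₃ hZ h1 h2 h3 h12 h13 h23
    by_cases e1 : W₁ = a ∪ a'
    · exact from12 hZ (h2 (fun h => h12 (e1.trans h.symm))) (h3 (fun h => h13 (e1.trans h.symm))) h23
    · by_cases e2 : W₂ = a ∪ a'
      · exact from12 hZ (h1 e1) (h3 (fun h => h23 (e2.trans h.symm))) h13
      · exact from12 hZ (h1 e1) (h2 e2) h12
  by_cases hall : a ∩ b = b ∩ b' ∧ a' ∩ b = b ∩ b' ∧ a ∩ b' = b ∩ b' ∧ a' ∩ b' = b ∩ b'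
  · -- all cross meets equal m: then no cross join equals u, and a ∪ b, a' ∪ b, a ∪ b' are pairwise distinct new joins
    obtain ⟨e1, e2, e3, e4⟩ := hall
    have hma : b ∩ b' ⊆ a := e1 ▸ inter_subset_left
    have hma' : b ∩ b' ⊆ a' := e2 ▸ inter_subset_left
    have nu1 : a ∪ b ≠ a ∪ a' := notu ha ha' hb haa ⟨z', hz'a', hz'a⟩ e2 hma
    have nu3 : a ∪ b' ≠ a ∪ a' := notu ha ha' hb' haa ⟨z', hz'a', hz'a⟩ e4 hma
    have nu2 : a' ∪ b ≠ a ∪ a' := by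
      have := notu ha' ha hb haa.symm ⟨z, hza, hza'⟩ e1 hma'; rwa [union_comm a' a] at this
    have h23 : a' ∪ b ≠ a ∪ b' := by
      intro h
      apply na'a
      intro t ht
      have : t ∈ a ∪ b' := h ▸ mem_union_left _ ht
      rcases mem_union.1 this with hta | htb'
      · exact hta
      · have : t ∈ a ∩ b' := by rw [e3, ← e4]; exact mem_inter.2 ⟨ht, htb'⟩
        exact (mem_inter.1 this).1
    exact from03 (nJ ha hb nu1) (nJ ha' hb nu2) (nJ ha hb' nu3) hα hρ h23
  · -- some cross meet is new
    have hZ : ∃ Z, Z ∈ newMeets P r := by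
      push Not at hall
      by_cases e1 : a ∩ b = b ∩ b'
      · by_cases e2 : a' ∩ b = b ∩ b'
        · by_cases e3 : a ∩ b' = b ∩ b'
          · exact ⟨_, nM ha' hb' (hall e1 e2 e3)⟩
          · exact ⟨_, nM ha hb' e3⟩
        · exact ⟨_, nM ha' hb e2⟩
      · exact ⟨_, nM ha hb e1⟩
    obtain ⟨Z, hZ⟩ := hZ
    by_cases h14 : a ∪ b = a' ∪ b'
    · by_cases h23 : a' ∪ b = a ∪ b'
      · -- crossed: both values are new (neither is u), and distinct
        have nu1 : a ∪ b ≠ a ∪ a' := by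
          intro hu
          have hb_u : b ⊆ a ∪ a' := by rw [← hu]; exact subset_union_right
          have ha_v : a ⊆ a' ∪ b := by rw [h23]; exact subset_union_left
          apply hα
          rw [hu]
          exact Subset.antisymm (union_subset ha_v subset_union_left) (union_subset subset_union_right hb_u)
        have nu2 : a' ∪ b ≠ a ∪ a' := by
          intro hu
          have hb_u : b ⊆ a ∪ a' := by rw [← hu]; exact subset_union_right
          have ha'_v : a' ⊆ a ∪ b := by rw [h14]; exact subset_union_left
          apply hα
          rw [hu]
          exact Subset.antisymm (union_subset subset_union_left hb_u) (union_subset subset_union_left ha'_v)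
        exact from12 hZ (nJ ha hb nu1) (nJ ha' hb nu2) hα
      · -- a ∪ b, a' ∪ b, a ∪ b' pairwise distinct
        exact twoOfThree hZ (nJ ha hb) (nJ ha' hb) (nJ ha hb') hα hρ h23
    · -- a ∪ b, a' ∪ b, a' ∪ b' pairwise distinct
      exact twoOfThree hZ (nJ ha hb) (nJ ha' hb) (nJ ha' hb') hα h14 hρ'

end TwoTwo

end Summit.CriticalPhenomena.PercolationContinuityZ3.Theorems.SahiColouredDaykin
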